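import Summits.CriticalPhenomena.PercolationContinuityZ3.Theorems.PercAnnulusCrossingIICManyPointsOneScaleCritical
import Summits.CriticalPhenomena.PercolationContinuityZ3.Theorems.PercAnnulusCrossingIICQuenchedPointUpper
import Summits.CriticalPhenomena.PercolationContinuityZ3.Theorems.PercAnnulusCrossingIICShellVolumesMixedMoments
import HarnessLib

/-!
# The shell volume of Kesten's IIC forgets the inside in mean: `E_ν[V_n ; H] ≍ E_ν[V_n]·ν(H)` (lane RSW3, p1 gen 20)

builds on p205010 (kernel theorem, internal audit signed; external expert review pending) — NOT used in this file
(only `p_c(ℤ^d) > 0`).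

RSW3 lane (LANE 3 `prim-rsw3`), seat `prim-rsw3-p1` (gen 20).  Helper file (`--supports stmt-CriticalPhenomena-4575`);
no definitions, no sorries.  Memo `run/shared/lean/prim/rsw3/P1-QM.md` §33.

Summing the two-sided quenched two-point bounds of gen 20 over the shell `S_n = {n ≤ ‖z‖_∞ ≤ 2n}` — the lower one
(`…IICManyPointsOneScaleCritical`, one site: `c_U·cπ(n)·ν(H) ≤ ν(H ∩ {0 ↔ z})`) and the upper one (`…IICQuenchedPointUpper`:
`ν(H ∩ {0 ↔ z}) ≤ Cπ(‖z‖)ν(H)`) — and comparing with `E_ν V_n ≍ #S_n·π(n)` (gen 19 (5)):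

* `setIntegral_card_filter_openConn_eq_sum` — `∫_H V_S dν = Σ_{z ∈ S} ν(H ∩ {0 ↔ z})` (`V_S = #{z ∈ S : 0 ↔ z}`);
* **`exists_setIntegral_shellVolume_two_sided_criticalProbI`** — at `p_c(ℤ^d)`, `d ≥ 2`, under (A2)□(s,L) + `CU⁺_l` + UAD: there are `n₀` and
  `0 < c ≤ C` such that for every finite measure `ν` with Kesten's IIC limit property, every `b ≥ 1`, every `n ≥ n₀(b+1)` and every local event
  `H` reading only the cluster of the origin inside `Λ(b)`, with `V_n = #{z : n ≤ ‖z‖_∞ ≤ 2n, 0 ↔ z}`: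
  **`c·E_ν[V_n]·ν(H) ≤ ∫_H V_n dν ≤ C·E_ν[V_n]·ν(H)`** — WHATEVER THE IIC DOES INSIDE `Λ(b)`, THE MEAN VOLUME OF ITS SHELL AT SCALE `n ≫ b` IS
  THE UNCONDITIONAL ONE UP TO CONSTANTS (conditional expectation `E_ν[V_n | H] ≍ E_ν[V_n]` uniformly in `H`).
References: H. Kesten, Probab. Theory Relat. Fields 73 (1986) Thm. (8); D. Basu, A. Sapozhnikov, ECP 22 (2017) Thm. 1.1.
-/

noncomputable section

namespace Summit.CriticalPhenomena.PercolationContinuityZ3.Theorems.Crossing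

open MeasureTheory Filter Topology Literature.Probability.Percolation Literature.Probability.LatticeModels
open Literature.Probability.Percolation.DCT16
open Summit.CriticalPhenomena.PercolationContinuityZ3.Theorems.SurfaceTension

variable {d : ℕ}

open Classical in
/-- **`∫_H #{z ∈ S : 0 ↔ z} dν = Σ_{z ∈ S} ν(H ∩ {0 ↔ z})`** for a finite measure `ν`, any set `H` and a finite set of sites `S`. [folklore] -/
theorem setIntegral_card_filter_openConn_eq_sum (ν : Measure (BondConfig (Site d))) [IsFiniteMeasure ν]
    (H : Set (BondConfig (Site d))) (S : Finset (Site d)) :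
    ∫ ω in H, (((S.filter fun z => ω ∈ (openConn (0 : Site d) z : Set (BondConfig (Site d)))).card : ℕ) : ℝ) ∂ν =
      ∑ z ∈ S, ν.real (H ∩ (openConn (0 : Site d) z : Set (BondConfig (Site d)))) := by
  rw [integral_card_filter_eq_sum (ν.restrict H) S _ fun z _ => measurableSet_openConn_holds 0 z]
  refine Finset.sum_congr rfl fun z _ => ?_
  rw [measureReal_restrict_apply (measurableSet_openConn_holds 0 z), Set.inter_comm]

open Classical in
/-- **THE SHELL VOLUME OF KESTEN'S IIC FORGETS THE INSIDE IN MEAN** (`p_c(ℤ^d)`, `d ≥ 2`; (A2)□ at aspect `(s,L)`, `2 ≤ s ≤ L`, `ϰ > 0`;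
`CU⁺_l(c_U)`, `l ≥ 2`, `c_U > 0`; UAD): there are `n₀ ≥ 1` and `0 < c, C` such that for every finite measure `ν` with Kesten's IIC limit property at
`p_c(ℤ^d)`, every inner scale `b ≥ 1`, every `n ≥ n₀(b+1)` and every local event `H` reading only the cluster of the origin inside `Λ(b)`
(with the states of the pairs at it), with the shell volume `V_n = #{z : n ≤ ‖z‖_∞ ≤ 2n, 0 ↔ z}`:
**`c·E_ν[V_n]·ν(H) ≤ ∫_H V_n dν ≤ C·E_ν[V_n]·ν(H)`**. [cite: Kesten1986, Thm. (8)] [cite: BasuSapozhnikov2017ECP, Thm. 1.1] -/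
theorem exists_setIntegral_shellVolume_two_sided_criticalProbI (hd : 2 ≤ d) {s L : ℕ} (hs : 2 ≤ s) (hsL : s ≤ L)
    {ϰ : ℝ} (hϰ : 0 < ϰ) (hA2 : SetToSetQuasiMultAspectAt d (criticalProbI d) s L ϰ) {l : ℕ} (hl : 2 ≤ l) {cU : ℝ} (hcU : 0 < cU)
    (hCU : ∀ a : ℕ, 1 ≤ a → ∀ E : Set (BondConfig (Site d)), IsUpperSet E → MeasurableSet E →
      cU * (bondPercolation (zdGraph d) (criticalProbI d)).real E ≤ (bondPercolation (zdGraph d) (criticalProbI d)).real (E ∩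
        {ω : BondConfig (Site d) | ∀ t ∈ innerBoundary (zdGraph d) (box d a), ∀ s ∈ innerBoundary (zdGraph d) (box d (l * a)),
          ∀ t' ∈ innerBoundary (zdGraph d) (box d a), ∀ s' ∈ innerBoundary (zdGraph d) (box d (l * a)),
          ω ∈ openConnIn (↑((box d (l * a) \ box d a) ∪ innerBoundary (zdGraph d) (box d a)) : Set (Site d)) t s →
          ω ∈ openConnIn (↑((box d (l * a) \ box d a) ∪ innerBoundary (zdGraph d) (box d a)) : Set (Site d)) t' s' →
          ω ∈ openConnIn (↑((box d (l * a) \ box d a) ∪ innerBoundary (zdGraph d) (box d a)) : Set (Site d)) s s'}))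
    (hUAD : ∀ ε : ℝ, 0 < ε → ∃ K₀ : ℕ, ∀ m : ℕ, 1 ≤ m → ∀ N : ℕ, K₀ * m ≤ N →
      (bondPercolation (zdGraph d) (criticalProbI d)).real (boxCrossing d m N) ≤ ε) :
    ∃ (n₀ : ℕ) (c C : ℝ), 1 ≤ n₀ ∧ 0 < c ∧ 0 < C ∧ ∀ (ν : Measure (BondConfig (Site d))) [IsFiniteMeasure ν],
      (∀ (F : Finset (Sym2 (Site d))) (E : Set (BondConfig (Site d))), MeasurableSet E → DeterminedBy E ↑F →
        Tendsto (fun n : ℕ => (bondPercolation (zdGraph d) (criticalProbI d)).real (E ∩ siteToBoundary d n) /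
          oneArmProb d (criticalProbI d) n) atTop (𝓝 (ν.real E))) →
      ∀ (b n : ℕ), 1 ≤ b → n₀ * (b + 1) ≤ n → ∀ (H : Set (BondConfig (Site d))), IsLocalEvent H →
        (∀ ω ω' : BondConfig (Site d), ω ⊆ (zdGraph d).edgeSet → ω' ⊆ (zdGraph d).edgeSet →
          (∀ x, ω ∈ openConnIn (↑(box d b) : Set (Site d)) 0 x ↔ ω' ∈ openConnIn (↑(box d b) : Set (Site d)) 0 x) →
          (∀ x y, ω ∈ openConnIn (↑(box d b) : Set (Site d)) 0 x → y ∈ box d (b + 1) → (s(x, y) ∈ ω ↔ s(x, y) ∈ ω')) →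
          ω ∈ H → ω' ∈ H) →
        c * (∫ ω, ((((box d (2 * n) \ box d (n - 1)).filter fun z =>
              ω ∈ (openConn (0 : Site d) z : Set (BondConfig (Site d)))).card : ℕ) : ℝ) ∂ν) * ν.real H ≤
            ∫ ω in H, ((((box d (2 * n) \ box d (n - 1)).filter fun z =>
              ω ∈ (openConn (0 : Site d) z : Set (BondConfig (Site d)))).card : ℕ) : ℝ) ∂ν ∧
          ∫ ω in H, ((((box d (2 * n) \ box d (n - 1)).filter fun z =>
              ω ∈ (openConn (0 : Site d) z : Set (BondConfig (Site d)))).card : ℕ) : ℝ) ∂ν ≤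
            C * (∫ ω, ((((box d (2 * n) \ box d (n - 1)).filter fun z =>
              ω ∈ (openConn (0 : Site d) z : Set (BondConfig (Site d)))).card : ℕ) : ℝ) ∂ν) * ν.real H := by
  have hd1 : 1 ≤ d := le_trans (by norm_num) hd
  obtain ⟨B, hB, hR2⟩ := Rsw3.exists_oneArmProb_ratio_of_setToSetQuasiMultAspectAt hd hs hsL hϰ hA2
  -- the three inputs
  obtain ⟨n₁, c₁, hn₁, hc₁, hlow⟩ := exists_iicMeasure_real_inter_biInter_openConnIn_ge_criticalProbI hd hs hsL hϰ hA2 hl hcU hCU hUAD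
  obtain ⟨C₂, hC₂, hup⟩ := exists_iicMeasure_real_inter_openConn_le_criticalProbI hd hs hsL hϰ hA2
  obtain ⟨n₃, c₃, C₃, hn₃, hc₃, hC₃, hsand⟩ := exists_iicMeasure_real_openConn_two_sided_criticalProbI hd hs hsL hϰ hA2 hl hcU hCU hUAD
  refine ⟨max (max n₁ (4 * s)) n₃, cU * c₁ / C₃, C₂ * B ^ 2 / c₃, le_trans hn₁ ((le_max_left _ _).trans (le_max_left _ _)),
    by positivity, by positivity, fun ν _ hν b n hb hn H hHl hH => ?_⟩
  set S : Finset (Site d) := box d (2 * n) \ box d (n - 1) with hS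
  set π := fun m => oneArmProb d (criticalProbI d) m with hπ
  have hn₀ : max (max n₁ (4 * s)) n₃ ≤ n := le_trans (Nat.le_mul_of_pos_right _ (by omega)) hn
  have hnn₁ : n₁ * b ≤ n := le_trans (Nat.mul_le_mul ((le_max_left _ _).trans (le_max_left _ _)) (Nat.le_succ b)) hn
  have hn4s : 4 * s * (b + 1) ≤ n := le_trans (Nat.mul_le_mul_right _ ((le_max_right _ _).trans (le_max_left _ _))) hn
  have hnn₃ : n₃ ≤ n := (le_max_right _ _).trans hn₀
  have hn1 : 1 ≤ n := le_trans hn₃ hnn₃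
  have hmem : ∀ z ∈ S, n ≤ Site.supNorm z ∧ Site.supNorm z ≤ 2 * n := by
    intro z hz
    simp only [hS, Finset.mem_sdiff, mem_box_iff_supNorm_le] at hz
    omega
  -- per-site bounds
  have hzlow : ∀ z ∈ S, cU * (c₁ * π n) * ν.real H ≤ ν.real (H ∩ (openConn (0 : Site d) z : Set (BondConfig (Site d)))) := by
    intro z hz
    have h := hlow ν hν b n hb hnn₁ H hHl hH {z} (fun w hw => by rw [Finset.mem_singleton.1 hw]; exact hmem z hz)
    rw [Finset.card_singleton, pow_one, Finset.set_biInter_singleton] at h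
    refine h.trans (measureReal_mono (Set.inter_subset_inter_right _ ?_) (measure_ne_top _ _))
    rw [Literature.Barriers.CriticalPhenomena.openConn_zero_eq_iUnion_openConnIn z]
    exact Set.subset_iUnion (fun m : ℕ => (openConnIn (↑(box d m) : Set (Site d)) (0 : Site d) z : Set (BondConfig (Site d)))) _
  have hzup : ∀ z ∈ S, ν.real (H ∩ (openConn (0 : Site d) z : Set (BondConfig (Site d)))) ≤ C₂ * B * π n * ν.real H := by
    intro z hz
    have hzn : 4 * s * (b + 1) ≤ Site.supNorm z := hn4s.trans (hmem z hz).1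
    have h := hup ν hν b hb H hHl hH z hzn
    have hratio : π (Site.supNorm z) ≤ B * π n := by
      have h1 : π (Site.supNorm z) ≤ π n := real_siteToBoundary_antitone _ (hmem z hz).1
      have hB1 : π n ≤ B * π n := by
        have := hR2 n n hn1 le_rfl (by omega)
        exact this
      exact h1.trans hB1
    calc ν.real (H ∩ (openConn (0 : Site d) z : Set (BondConfig (Site d)))) ≤ C₂ * π (Site.supNorm z) * ν.real H := h
      _ ≤ C₂ * (B * π n) * ν.real H :=
          mul_le_mul_of_nonneg_right (mul_le_mul_of_nonneg_left hratio hC₂.le) measureReal_nonneg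
      _ = C₂ * B * π n * ν.real H := by ring
  -- the unconditional mean, two-sided
  have hmean_eq : ∫ ω, (((S.filter fun z => ω ∈ (openConn (0 : Site d) z : Set (BondConfig (Site d)))).card : ℕ) : ℝ) ∂ν =
      ∑ z ∈ S, ν.real (openConn (0 : Site d) z) := integral_card_filter_eq_sum ν S _ fun z _ => measurableSet_openConn_holds 0 z
  have hmean_up : ∫ ω, (((S.filter fun z => ω ∈ (openConn (0 : Site d) z : Set (BondConfig (Site d)))).card : ℕ) : ℝ) ∂ν ≤
      S.card * (C₃ * π n) := by
    rw [hmean_eq]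
    calc ∑ z ∈ S, ν.real (openConn (0 : Site d) z) ≤ ∑ z ∈ S, C₃ * π n := by
          refine Finset.sum_le_sum fun z hz => ?_
          have h := (hsand ν hν _ z (hnn₃.trans (hmem z hz).1) (self_mem_sphere z)).2
          exact h.trans (mul_le_mul_of_nonneg_left (real_siteToBoundary_antitone _ (hmem z hz).1) hC₃.le)
      _ = S.card * (C₃ * π n) := by rw [Finset.sum_const, nsmul_eq_mul]
  have hmean_low : S.card * (c₃ / B * π n) ≤
      ∫ ω, (((S.filter fun z => ω ∈ (openConn (0 : Site d) z : Set (BondConfig (Site d)))).card : ℕ) : ℝ) ∂ν := by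
    rw [hmean_eq]
    calc (S.card : ℝ) * (c₃ / B * π n) = ∑ z ∈ S, c₃ / B * π n := by rw [Finset.sum_const, nsmul_eq_mul]
      _ ≤ ∑ z ∈ S, ν.real (openConn (0 : Site d) z) := by
          refine Finset.sum_le_sum fun z hz => ?_
          have h := (hsand ν hν _ z (hnn₃.trans (hmem z hz).1) (self_mem_sphere z)).1
          have hratio : π n ≤ B * π (Site.supNorm z) := hR2 n _ hn1 (hmem z hz).1 (by have := (hmem z hz).2; omega)
          calc c₃ / B * π n ≤ c₃ / B * (B * π (Site.supNorm z)) := mul_le_mul_of_nonneg_left hratio (by positivity)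
            _ = c₃ * π (Site.supNorm z) := by field_simp
            _ ≤ _ := h
  -- assemble
  rw [setIntegral_card_filter_openConn_eq_sum ν H S]
  have hH0 : 0 ≤ ν.real H := measureReal_nonneg
  have hπ0 : 0 ≤ π n := by simp only [hπ]; unfold oneArmProb; exact measureReal_nonneg
  constructor
  · calc cU * c₁ / C₃ * (∫ ω, (((S.filter fun z => ω ∈ (openConn (0 : Site d) z : Set (BondConfig (Site d)))).card : ℕ) : ℝ) ∂ν) * ν.real H
        ≤ cU * c₁ / C₃ * (S.card * (C₃ * π n)) * ν.real H :=
          mul_le_mul_of_nonneg_right (mul_le_mul_of_nonneg_left hmean_up (by positivity)) hH0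
      _ = ∑ z ∈ S, cU * (c₁ * π n) * ν.real H := by rw [Finset.sum_const, nsmul_eq_mul]; field_simp
      _ ≤ ∑ z ∈ S, ν.real (H ∩ (openConn (0 : Site d) z : Set (BondConfig (Site d)))) := Finset.sum_le_sum hzlow
  · calc ∑ z ∈ S, ν.real (H ∩ (openConn (0 : Site d) z : Set (BondConfig (Site d))))
        ≤ ∑ z ∈ S, C₂ * B * π n * ν.real H := Finset.sum_le_sum hzup
      _ = C₂ * B ^ 2 / c₃ * (S.card * (c₃ / B * π n)) * ν.real H := by rw [Finset.sum_const, nsmul_eq_mul]; field_simp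
      _ ≤ C₂ * B ^ 2 / c₃ * (∫ ω, (((S.filter fun z => ω ∈ (openConn (0 : Site d) z : Set (BondConfig (Site d)))).card : ℕ) : ℝ) ∂ν) *
            ν.real H := mul_le_mul_of_nonneg_right (mul_le_mul_of_nonneg_left hmean_low (by positivity)) hH0

end Summit.CriticalPhenomena.PercolationContinuityZ3.Theorems.Crossing

end
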